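import Summits.QuantumFields.YangMills.Theorems.BalabanUVNodesN26AtRecord13Family

/-!
# DAG node N26 — CRUX K2‴'s REGISTERED STUB `stub_d4AtSlopeCont13 : D4AtSlopeOfD1Record13` AT THE TUPLE θ, IN THE STUB's OWN LETTERS, FROM THE (D4) FAMILY ROAD AT THE
# FAITHFUL STAGE-13 LETTERS — and AT NODE 00's OPEN-LETTER WITNESS FAMILIES `θ₁₃(ε₀, ε₂₉)` ∕ `θ₁₃(n, ε₂₉)` with N1 discharged modulo the displayed `ε₂₉`-inequality
# (B4 ∕ N26 at the all-numerics member too)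

Cell `pub-ymgap`, YM-PLAN Track A (HUMAN RULING D-0062), seat `pub-ymgap-dag-n26-c` gen 6 (R134 acceleration seat, s2); helper for crux K2‴ `EndpointGivenBR13`
(stmt-QuantumFields-19911, route `BalabanUVNodes` rev 16).  Plan g66's REGISTERED K2‴ skeleton (`K2Skeleton13.lean`, sha 3f282f2a…, 2026-08-27T03:16:17Z): two stubs,
`stub_d1Residue13 : D1AtRecord13` (row (D1), N25's side) and **`stub_d4AtSlopeCont13 : D4AtSlopeOfD1Record13`** (rows (D4) ∧ B4 at (D1)'s slope, N26 ∕ NODE O's side), composed by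
`Gaps.BetaContFromD4Chain.endpointExistence_of_residue_atSlopeCont`.  The second stub's body at `(F, θ)` reads, for every (D1) datum `(Lc, Js, Nc)` pinned on the record's one-loop
numbers, `∃ γ₀, 0 < γ₀ ∧ γ₀ ≤ θ.γ ∧ AtSlopeCont (oneLoopSplit_betaOfMerged β_m (beta0OfMerged β_m θ.v₀) θ.γ) γ₀ (stepBal Nc Lc)` with
`β_m := betaMerged F (mergedTermFamilyMatT F 2 (TcanOfRecord F 2) (chiFixed29 F 2 θ.ν θ.ε₂₉) θ.εbg) θ.ρ8 θ.bV` — the ₁₃ β-tokens this seat's `…N26AtRecord13` (p491248) §1b is keyed to.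
dag-ref-D READ-148 ∕ READ-156 CONSUMER READ RULE: a theorem feeding this stub cites the family road ONLY at the FAITHFUL letters `{ c₀ with ε₁ := θ.ε₂₉ }` with the record small row
displayed, and instantiates at K0a's OPEN-letter family (FILE 9), never at the pinned member of record.

WHAT IS HERE (0 `def`, 0 `sorry`; five compositions BY NAME; general `N`, the stub's `N = 2` an instance).
§1 `d4AtSlopeOfD1Record13_at_of_family_faithful` — THE STUB's CONCLUSION AT `(F, N, θ)` for a given (D1) datum's slope `stepBal Nc Lc` ⇐ the Stage-12 [B13] family of record
`lamF` at `θ.toStage12Params` whose member letters are THE FAITHFUL LETTERS OF RECORD `c13OfRecord₁₂ θ.toStage12Params { c₀ with ε₁ := θ.ε₂₉ }`, the (1.22) identification `hm` at the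
₁₃ merged β on a box `0 < γ₀ ≤ θ.γ`, N10's family leaf, run sequences ∕ laws ∕ restriction sentences, N1 `hC` AT THE FAITHFUL LETTERS (displayed — at a general θ it is the record's
κ–ε₁ inequality, p491248 `condsL_faithful_stage13_iff_of_kappa_ge`), N3, the (4.4) seams with holomorphic activities, the (190) ∕ (1.7) data, the one-loop smallness
`θ.ε₂₉ · K_rem,L(faithful letters) ≤ stepBal Nc Lc` and (C-leaf) — p491248's `atSlopeCont_betaOfRecord₁₃_of_family_leafwise` at the faithful letters, wrapped in the stub's `∃ γ₀`.
§2 `d4AtSlopeOfD1Record13_at_theta13LiveOfFamily₂_of_family` — THE SAME AT NODE 00's WITNESS FAMILY `θ := theta13LiveOfFamily₂ F N ε₀ ε₂₉ ζ Rz Zt` (K0a FILE 9): N1 DISCHARGED modulo the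
two displayed inequalities `hsmall : 2(F.L+2)⁴·A₁·K₀(c₀)·ε₂₉·e^{100001}·K₀(64,8)·576 ≤ 1`, `hA₂ : e·576·K₀(64,8)² ≤ A₂` (`…N26AtRecord13Family.condsL_faithful_theta13LiveOfFamily₂_of_eps_le`),
box `0 < γ₀ ≤ ½ = θ₁₃.γ`.  The (D1) pin ∕ residue hypotheses of the stub are not used by the β-remainder side (as at ₁₂, p470063 ∕ p478229).
§3 AT THE ALL-NUMERICS FAMILY `θ₁₃(n, ε₂₉) := theta13LiveOfNumerics F N n ε₂₉ ζ Rz Zt` (K0a FILE 9 §3 — every numeric letter an argument; the socket the K0‴ discharge candidates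
keyed to print's undetermined constants instantiate; the two-letter family is its member `n := stage12NumericsOfFamily ε₀`, `rfl`): `d4AtSlopeOfD1Record13_at_theta13LiveOfNumerics_of_family`,
`betaContH_betaOfRecord₁₃_theta13LiveOfNumerics_of_family`, `n26_datumOfRecord₁₃_theta13LiveOfNumerics_of_family` — the stub at the member, B4 on the box, N26 at the member's datum, with the
κ threshold `20·(64·log 162 + 1) ≤ κ(n)` DISPLAYED and N1 discharged modulo it and `hsmall₁` (in `n`'s letters `E₀(n)`, `κ(n)`), `hA₂`; box `0 < γ₀ ≤ γ(n)`.

HONEST FRAMING.  REDUCTIONS of the registered stub at θ to displayed inputs on the record's residual objects — NOT a proof of `stub_d4AtSlopeCont13` (which quantifies over EVERY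
admissible θ, including members above the small-row threshold where this road says nothing, `…N26AtRecord13Family.not_condsL_faithful_theta13LiveOfRecord`); (D4) INSTANCE 0∕1; the
family of record, `hm`, laws, seams, (190) ∕ (1.7) data, N3, (C-leaf) are displayed HYPOTHESES (NODE O ∕ def-T ∕ NODE B ∕ NODE E objects); K2‴ NOT proved; N25 ∕ N26 NOT discharged;
counts unmoved.  One finite four-torus programme at fixed ε per run — NOT the continuum limit, NOT ℝ⁴, NOT OS, NOT a mass gap, NOT Clay.  No `instance`, no `notation`, no `axiom`.
Sources (context): [I] = [Balaban1987RG1] CMP **109** (1987): (1.7) p. 261, (1.20)–(1.22) p. 264, (2.9) p. 266, (2.12)–(2.13) p. 268, (5.1) p. 292, (5.10) p. 293;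
[II] = [Balaban1988RG2Cluster] CMP **116** (1988): Lemma 3 (2.38) p. 20, p. 21; [15] = [Balaban1985Variational] CMP **102** (1985): (190) p. 308.
-/

noncomputable section

open scoped Matrix.Norms.L2Operator

namespace Summit.QuantumFields.YangMills.Theorems.BalabanUVNodesN26AtRecord13K2Stub

open Literature.MathematicalPhysics.QuantumFieldTheory.Balaban1983to89
open Literature.MathematicalPhysics.QuantumFieldTheory.Balaban1983to89.FlowStep
open Literature.MathematicalPhysics.QuantumFieldTheory.Balaban1983to89.T4Continuum (T4Family)
open Literature.MathematicalPhysics.QuantumFieldTheory.Balaban1983to89.Node00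
open Literature.MathematicalPhysics.QuantumFieldTheory.Balaban1983to89.B13ScaleTransfer (Pt)
open Literature.MathematicalPhysics.QuantumFieldTheory.Balaban1983to89.B12TreeDecay (K₀)
open Literature.MathematicalPhysics.QuantumFieldTheory.Balaban1983to89.Beta.RemainderChainLattice
open Literature.MathematicalPhysics.QuantumFieldTheory.Balaban1983to89.TreeLengthTorus (TDom proj)
open Literature.MathematicalPhysics.QuantumFieldTheory.Balaban1983to89.B12Decay510 (mixedDeriv)
open Literature.MathematicalPhysics.QuantumFieldTheory.Balaban1983to89.Beta.RemainderLimitTorus (LDom limKernel tproj)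
open Literature.MathematicalPhysics.QuantumFieldTheory.Balaban1983to89.Beta.RemainderWOfRecordB13
open Literature.MathematicalPhysics.QuantumFieldTheory.Balaban1983to89.Beta.RemainderDecay190
open Summit.QuantumFields.BalabanUV.Gaps
open Summit.QuantumFields.BalabanUV.Gaps.BetaContFromD4Chain
open Summit.QuantumFields.YangMills.Theorems.BalabanUVNodesN26AtRecord13 (atSlopeCont_betaOfRecord₁₃_of_family_leafwise betaContH_betaOfRecord₁₃_of_family)
open Summit.QuantumFields.YangMills.Theorems.BalabanUVNodesN26AtRecord13Family
  (condsL_faithful_theta13LiveOfFamily₂_of_eps_le condsL_faithful_theta13LiveOfNumerics_iff_of_kappa_ge)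
open Metric
open Filter Topology

variable (F : T4Family) (N : ℕ) [NeZero N]

/-! ## §1 The registered stub's conclusion AT θ from the family road at the FAITHFUL Stage-13 letters (N1 displayed) -/

section AtTheta

variable {γ₀ : ℝ} {M : ℕ} [NeZero M] {μ ν : Fin 4} {α₂ : ℝ} {q : Consts190}
variable (θ : Stage13Params F N) (c₀ : B13.Consts) (lamF : ResidB13Fam₁₂ F N θ.toStage12Params) (hγ₀ : 0 < γ₀) (hle : γ₀ ≤ θ.γ)
  -- the leaf kernels and the (1.22) identification AT THE STAGE-13 MERGED β (canonical transport, (2.9) species) on the box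
  (A1 : (k : ℕ) → (Fin (k + 1) → ℝ) → LDom 4 → Pt 4 → ℝ)
  (hm : letI := θ.instVβ₁; letI := θ.instVβ₂; letI := θ.instιβ
    ∀ k (v : Fin (k + 1) → ℝ), v ∈ Box γ₀ k →
      betaMerged F (mergedTermFamilyMatT F N (TcanOfRecord F N) (chiFixed29 F N θ.ν θ.ε₂₉) θ.εbg) θ.ρ8 θ.bV k v =
        beta0OfMerged (betaMerged F (mergedTermFamilyMatT F N (TcanOfRecord F N) (chiFixed29 F N θ.ν θ.ε₂₉) θ.εbg) θ.ρ8 θ.bV) θ.v₀ k +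
          B12Beta.secondMoment (fun _ _ => limKernel (A1 k v)) μ ν)
  -- N10's in-edge in the FAMILY currency at every run and the member letters law on the box, AT THE FAITHFUL LETTERS OF RECORD
  (hcF : ∀ P k v, v ∈ Box γ₀ k → (lamF P k v).c = c13OfRecord₁₂ F N θ.toStage12Params { c₀ with ε₁ := θ.ε₂₉ })
  (hleafF : ∀ P, B13FamLeafOfRecord₁₂ F N θ.toStage12Params { c₀ with ε₁ := θ.ε₂₉ } lamF P)
  -- per (scale, history) IN THE BOX: a run sequence whose families' members AT THAT HISTORY have growing coarse tori, their laws and restriction sentences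
  (Ps : (k : ℕ) → (Fin (k + 1) → ℝ) → ℕ → B12.RunParams)
  (hn : ∀ k v, v ∈ Box γ₀ k → Tendsto (fun m => (lamF (Ps k v m) k v).n) atTop atTop)
  (hsp : ∀ k v, v ∈ Box γ₀ k → ∀ m, SpLaw (lamF (Ps k v m) k v)) (h213 : ∀ k v, v ∈ Box γ₀ k → ∀ m, Law213 (lamF (Ps k v m) k v))
  (hR : ∀ k v, v ∈ Box γ₀ k → ∀ m, (lamF (Ps k v m) k v).Restr)
  -- N1 AT THE FAITHFUL LETTERS (the record's κ–ε₁ inequality at a general θ) and N3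
  (hC : CondsL 4 (c13OfRecord₁₂ F N θ.toStage12Params { c₀ with ε₁ := θ.ε₂₉ })
    (((c13OfRecord₁₂ F N θ.toStage12Params { c₀ with ε₁ := θ.ε₂₉ }).L : ℝ) / 2))
  (hs : SignsL (c13OfRecord₁₂ F N θ.toStage12Params { c₀ with ε₁ := θ.ε₂₉ }) α₂ q.B₃)
  -- the (4.4) seams with holomorphic activities, the (190) data, the (1.7) ∕ test-vector-limit data with the read-out of the leaf kernels (on the box)
  (Wn : (k : ℕ) → (Fin (k + 1) → ℝ) → ℕ → Type) (instW : ∀ k v m, NormedAddCommGroup (Wn k v m))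
  (instWs : ∀ k v m, NormedSpace ℂ (Wn k v m))
  (emb : (k : ℕ) → (v : Fin (k + 1) → ℝ) → (m : ℕ) → TDom 4 ((lamF (Ps k v m) k v).n + 1) → Wn k v m → (lamF (Ps k v m) k v).Φ)
  (hemb : ∀ k v, v ∈ Box γ₀ k → ∀ m X, ∀ u ∈ ball (0 : Wn k v m) α₂, emb k v m X u ∈ (lamF (Ps k v m) k v).sp2 X)
  (hH : ∀ k v, v ∈ Box γ₀ k → ∀ m (X Z : TDom 4 ((lamF (Ps k v m) k v).n + 1)), Z.1 ⊆ X.1 →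
    DifferentiableOn ℂ (fun u => (lamF (Ps k v m) k v).H Z (emb k v m X u)) (ball 0 α₂))
  (D : (k : ℕ) → (v : Fin (k + 1) → ℝ) → Data190 4 M (NOfLayers fun m => lamF (Ps k v m) k v) (Wn k v) q)
  (V : (k : ℕ) → (Fin (k + 1) → ℝ) → LDom 4 → Type) (instV : ∀ k v Y, NormedAddCommGroup (V k v Y))
  (instVs : ∀ k v Y, NormedSpace ℂ (V k v Y))
  (Fw : (k : ℕ) → (v : Fin (k + 1) → ℝ) → (Y : LDom 4) → V k v Y → ℂ)
  (hFd : ∀ k v, v ∈ Box γ₀ k → ∀ Y, ∃ ρ > 0, DifferentiableOn ℂ (Fw k v Y) (ball 0 ρ))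
  (r : (k : ℕ) → (v : Fin (k + 1) → ℝ) → (m : ℕ) → (Y : LDom 4) → Wn k v m →L[ℂ] V k v Y)
  (hfac : ∀ k v, v ∈ Box γ₀ k → ∀ Y : LDom 4, ∀ᶠ m in atTop, ∀ u ∈ ball (0 : Wn k v m) α₂,
    (lamF (Ps k v m) k v).Ek1 (tproj ((lamF (Ps k v m) k v).n + 1) Y) (emb k v m (tproj ((lamF (Ps k v m) k v).n + 1) Y) u) =
      Fw k v Y (r k v m Y u))
  (t : (k : ℕ) → (v : Fin (k + 1) → ℝ) → (Y : LDom 4) → Pt 4 → V k v Y)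
  (hconv : ∀ k v, v ∈ Box γ₀ k → ∀ (Y : LDom 4) (x : Pt 4),
    Tendsto (fun m => r k v m Y ((D k v).hn m (tproj ((lamF (Ps k v m) k v).n + 1) Y) (proj (((lamF (Ps k v m) k v).n + 1) * M) x)))
      atTop (𝓝 (t k v Y x)))
  (ha : ∀ k v, v ∈ Box γ₀ k → ∀ (Y : LDom 4) (z : Pt 4), A1 k v Y z = (mixedDeriv (Fw k v Y) (t k v Y 0) (t k v Y z)).re)

include hγ₀ hle hm hcF hleafF hn hsp h213 hR hC hs instW instWs hemb hH hFd hfac hconv ha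

/-- **CRUX K2‴'s REGISTERED STUB `stub_d4AtSlopeCont13 : D4AtSlopeOfD1Record13` AT THE TUPLE θ, IN THE STUB's OWN LETTERS, FROM THE FAMILY ROAD AT THE FAITHFUL STAGE-13
LETTERS**: the stub's conclusion at `(F, θ)` for a (D1) datum's slope `stepBal Nc Lc` — `∃ γ₁, 0 < γ₁ ∧ γ₁ ≤ θ.γ ∧ AtSlopeCont (split₁₃ θ) γ₁ (stepBal Nc Lc)` — ⇐ the family list on a box
`0 < γ₀ ≤ θ.γ` at the faithful letters + the (1.22) identification at the ₁₃ merged β + N1 (at the faithful letters: the record's κ–ε₁ inequality) + N3 + the one-loop smallness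
`θ.ε₂₉·K_rem,L ≤ stepBal Nc Lc` + (C-leaf) (p491248 `atSlopeCont_betaOfRecord₁₃_of_family_leafwise`, `γ₁ := γ₀`).  A REDUCTION of the stub at θ — NOT a proof of it (instance 0∕1;
the (D1) pin and residue are not used by the β-remainder side). [cite: Balaban1988RG2Cluster, Lemma 3 (2.38) p.20 and p.21; Balaban1987RG1, (1.7) p.261, (1.20)-(1.22) p.264, (2.9) p.266, (2.12)-(2.13) p.268 and (5.1) p.292; Balaban1985Variational, (190) p.308] -/
theorem d4AtSlopeOfD1Record13_at_of_family_faithful (hq : q.Valid (c13OfRecord₁₂ F N θ.toStage12Params { c₀ with ε₁ := θ.ε₂₉ }).δ₀) {Lc : ℕ} {Nc : ℝ}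
    (hsmall : θ.ε₂₉ * remCoeffL 4 M (c13OfRecord₁₂ F N θ.toStage12Params { c₀ with ε₁ := θ.ε₂₉ }) α₂ q.B₃ ≤ B12Normalization.stepBal Nc Lc)
    (hcont : ∀ k (Y : LDom 4) (z : Pt 4),
      ContinuousOn (fun v : Fin (k + 1) → ℝ => (mixedDeriv (Fw k v Y) (t k v Y 0) (t k v Y z)).re) (Box γ₀ k)) :
    letI := θ.instVβ₁; letI := θ.instVβ₂; letI := θ.instιβ
    ∃ γ₁ : ℝ, 0 < γ₁ ∧ γ₁ ≤ θ.γ ∧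
      AtSlopeCont
        (oneLoopSplit_betaOfMerged (betaMerged F (mergedTermFamilyMatT F N (TcanOfRecord F N) (chiFixed29 F N θ.ν θ.ε₂₉) θ.εbg) θ.ρ8 θ.bV)
          (beta0OfMerged (betaMerged F (mergedTermFamilyMatT F N (TcanOfRecord F N) (chiFixed29 F N θ.ν θ.ε₂₉) θ.εbg) θ.ρ8 θ.bV) θ.v₀) θ.γ)
        γ₁ (B12Normalization.stepBal Nc Lc) :=
  ⟨γ₀, hγ₀, hle,
    atSlopeCont_betaOfRecord₁₃_of_family_leafwise F N θ { c₀ with ε₁ := θ.ε₂₉ } lamF hle A1 hm hcF hleafF Ps hn hsp h213 hR hC hs Wn instW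
      instWs emb hemb hH D V instV instVs Fw hFd r hfac t hconv ha hq hsmall hcont⟩

end AtTheta

/-! ## §2 The same AT NODE 00's open-letter witness family `θ₁₃(ε₀, ε₂₉)`: N1 discharged modulo the displayed `hsmall₁`, `hA₂` -/

section AtFamily

variable {γ₀ : ℝ} {M : ℕ} [NeZero M] {μ ν : Fin 4} {α₂ : ℝ} {q : Consts190}
variable (ε₀ ε₂₉ : ℝ) (ζ : ZetaOfRecord F N (numerics7OfFamily ε₀) 1) (Rz : (K : ℕ) → Sect2.Residual (F.P K) (MatA N))
  (Zt : (K : ℕ) → TkResidualW F N (FluctV N) K) (c₀ : B13.Consts)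
  (lamF : ResidB13Fam₁₂ F N (theta13LiveOfFamily₂ F N ε₀ ε₂₉ ζ Rz Zt).toStage12Params) (hγ₀ : 0 < γ₀) (hle : γ₀ ≤ 1 / 2)
  (A1 : (k : ℕ) → (Fin (k + 1) → ℝ) → LDom 4 → Pt 4 → ℝ)
  (hm : letI := (theta13LiveOfFamily₂ F N ε₀ ε₂₉ ζ Rz Zt).instVβ₁; letI := (theta13LiveOfFamily₂ F N ε₀ ε₂₉ ζ Rz Zt).instVβ₂
    letI := (theta13LiveOfFamily₂ F N ε₀ ε₂₉ ζ Rz Zt).instιβ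
    ∀ k (v : Fin (k + 1) → ℝ), v ∈ Box γ₀ k →
      betaMerged F (mergedTermFamilyMatT F N (TcanOfRecord F N)
          (chiFixed29 F N (theta13LiveOfFamily₂ F N ε₀ ε₂₉ ζ Rz Zt).ν (theta13LiveOfFamily₂ F N ε₀ ε₂₉ ζ Rz Zt).ε₂₉)
          (theta13LiveOfFamily₂ F N ε₀ ε₂₉ ζ Rz Zt).εbg) (theta13LiveOfFamily₂ F N ε₀ ε₂₉ ζ Rz Zt).ρ8
          (theta13LiveOfFamily₂ F N ε₀ ε₂₉ ζ Rz Zt).bV k v =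
        beta0OfMerged (betaMerged F (mergedTermFamilyMatT F N (TcanOfRecord F N)
            (chiFixed29 F N (theta13LiveOfFamily₂ F N ε₀ ε₂₉ ζ Rz Zt).ν (theta13LiveOfFamily₂ F N ε₀ ε₂₉ ζ Rz Zt).ε₂₉)
            (theta13LiveOfFamily₂ F N ε₀ ε₂₉ ζ Rz Zt).εbg) (theta13LiveOfFamily₂ F N ε₀ ε₂₉ ζ Rz Zt).ρ8
            (theta13LiveOfFamily₂ F N ε₀ ε₂₉ ζ Rz Zt).bV) (theta13LiveOfFamily₂ F N ε₀ ε₂₉ ζ Rz Zt).v₀ k +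
          B12Beta.secondMoment (fun _ _ => limKernel (A1 k v)) μ ν)
  (hcF : ∀ P k v, v ∈ Box γ₀ k →
    (lamF P k v).c = c13OfRecord₁₂ F N (theta13LiveOfFamily₂ F N ε₀ ε₂₉ ζ Rz Zt).toStage12Params { c₀ with ε₁ := ε₂₉ })
  (hleafF : ∀ P, B13FamLeafOfRecord₁₂ F N (theta13LiveOfFamily₂ F N ε₀ ε₂₉ ζ Rz Zt).toStage12Params { c₀ with ε₁ := ε₂₉ } lamF P)
  (Ps : (k : ℕ) → (Fin (k + 1) → ℝ) → ℕ → B12.RunParams)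
  (hn : ∀ k v, v ∈ Box γ₀ k → Tendsto (fun m => (lamF (Ps k v m) k v).n) atTop atTop)
  (hsp : ∀ k v, v ∈ Box γ₀ k → ∀ m, SpLaw (lamF (Ps k v m) k v)) (h213 : ∀ k v, v ∈ Box γ₀ k → ∀ m, Law213 (lamF (Ps k v m) k v))
  (hR : ∀ k v, v ∈ Box γ₀ k → ∀ m, (lamF (Ps k v m) k v).Restr)
  (hsmall₁ : 2 * ((F.L : ℝ) + 2) ^ 4 * c₀.A₁ * c₀.K₀ * ε₂₉ * Real.exp (5 * 20000 + 1) * K₀ 64 8 * 9 * 64 ≤ 1)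
  (hA₂ : Real.exp 1 * 9 * 64 * K₀ 64 8 ^ 2 ≤ c₀.A₂)
  (hs : SignsL (c13OfRecord₁₂ F N (theta13LiveOfFamily₂ F N ε₀ ε₂₉ ζ Rz Zt).toStage12Params { c₀ with ε₁ := ε₂₉ }) α₂ q.B₃)
  (Wn : (k : ℕ) → (Fin (k + 1) → ℝ) → ℕ → Type) (instW : ∀ k v m, NormedAddCommGroup (Wn k v m))
  (instWs : ∀ k v m, NormedSpace ℂ (Wn k v m))
  (emb : (k : ℕ) → (v : Fin (k + 1) → ℝ) → (m : ℕ) → TDom 4 ((lamF (Ps k v m) k v).n + 1) → Wn k v m → (lamF (Ps k v m) k v).Φ)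
  (hemb : ∀ k v, v ∈ Box γ₀ k → ∀ m X, ∀ u ∈ ball (0 : Wn k v m) α₂, emb k v m X u ∈ (lamF (Ps k v m) k v).sp2 X)
  (hH : ∀ k v, v ∈ Box γ₀ k → ∀ m (X Z : TDom 4 ((lamF (Ps k v m) k v).n + 1)), Z.1 ⊆ X.1 →
    DifferentiableOn ℂ (fun u => (lamF (Ps k v m) k v).H Z (emb k v m X u)) (ball 0 α₂))
  (D : (k : ℕ) → (v : Fin (k + 1) → ℝ) → Data190 4 M (NOfLayers fun m => lamF (Ps k v m) k v) (Wn k v) q)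
  (V : (k : ℕ) → (Fin (k + 1) → ℝ) → LDom 4 → Type) (instV : ∀ k v Y, NormedAddCommGroup (V k v Y))
  (instVs : ∀ k v Y, NormedSpace ℂ (V k v Y))
  (Fw : (k : ℕ) → (v : Fin (k + 1) → ℝ) → (Y : LDom 4) → V k v Y → ℂ)
  (hFd : ∀ k v, v ∈ Box γ₀ k → ∀ Y, ∃ ρ > 0, DifferentiableOn ℂ (Fw k v Y) (ball 0 ρ))
  (r : (k : ℕ) → (v : Fin (k + 1) → ℝ) → (m : ℕ) → (Y : LDom 4) → Wn k v m →L[ℂ] V k v Y)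
  (hfac : ∀ k v, v ∈ Box γ₀ k → ∀ Y : LDom 4, ∀ᶠ m in atTop, ∀ u ∈ ball (0 : Wn k v m) α₂,
    (lamF (Ps k v m) k v).Ek1 (tproj ((lamF (Ps k v m) k v).n + 1) Y) (emb k v m (tproj ((lamF (Ps k v m) k v).n + 1) Y) u) =
      Fw k v Y (r k v m Y u))
  (t : (k : ℕ) → (v : Fin (k + 1) → ℝ) → (Y : LDom 4) → Pt 4 → V k v Y)
  (hconv : ∀ k v, v ∈ Box γ₀ k → ∀ (Y : LDom 4) (x : Pt 4),
    Tendsto (fun m => r k v m Y ((D k v).hn m (tproj ((lamF (Ps k v m) k v).n + 1) Y) (proj (((lamF (Ps k v m) k v).n + 1) * M) x)))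
      atTop (𝓝 (t k v Y x)))
  (ha : ∀ k v, v ∈ Box γ₀ k → ∀ (Y : LDom 4) (z : Pt 4), A1 k v Y z = (mixedDeriv (Fw k v Y) (t k v Y 0) (t k v Y z)).re)

include hγ₀ hle hm hcF hleafF hn hsp h213 hR hsmall₁ hA₂ hs instW instWs hemb hH hFd hfac hconv ha

/-- **THE REGISTERED STUB's CONCLUSION AT NODE 00's WITNESS FAMILY `θ₁₃(ε₀, ε₂₉) = theta13LiveOfFamily₂ F N ε₀ ε₂₉ ζ Rz Zt`** for a (D1) datum's slope `stepBal Nc Lc`, N1 DISCHARGED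
modulo the displayed `hsmall₁` (the open letter below the threshold) and `hA₂` (K0a FILE 9's consumer shape; dag-ref-D READ-148 ∕ READ-156): `∃ γ₁, 0 < γ₁ ∧ γ₁ ≤ θ₁₃.γ ∧
AtSlopeCont (split₁₃ θ₁₃) γ₁ (stepBal Nc Lc)` ⇐ the family list at the member's faithful letters on a box `0 < γ₀ ≤ ½` + (1.22) `hm` + N3 + the one-loop smallness + (C-leaf) (§1 at
`θ := θ₁₃(ε₀, ε₂₉)`, `hC := condsL_faithful_theta13LiveOfFamily₂_of_eps_le hsmall₁ hA₂`).  A REDUCTION at the member — instance 0∕1; `stub_d4AtSlopeCont13` NOT proved.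
[cite: Balaban1988RG2Cluster, Lemma 3 (2.38) p.20 and p.21; Balaban1987RG1, (1.2) p.260, (1.7) p.261, (1.20)-(1.22) p.264, (2.9) p.266 and (5.1) p.292; Balaban1985Variational, (190) p.308] -/
theorem d4AtSlopeOfD1Record13_at_theta13LiveOfFamily₂_of_family
    (hq : q.Valid (c13OfRecord₁₂ F N (theta13LiveOfFamily₂ F N ε₀ ε₂₉ ζ Rz Zt).toStage12Params { c₀ with ε₁ := ε₂₉ }).δ₀) {Lc : ℕ} {Nc : ℝ}
    (hsmall : ε₂₉ * remCoeffL 4 M (c13OfRecord₁₂ F N (theta13LiveOfFamily₂ F N ε₀ ε₂₉ ζ Rz Zt).toStage12Params { c₀ with ε₁ := ε₂₉ }) α₂ q.B₃ ≤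
      B12Normalization.stepBal Nc Lc)
    (hcont : ∀ k (Y : LDom 4) (z : Pt 4),
      ContinuousOn (fun v : Fin (k + 1) → ℝ => (mixedDeriv (Fw k v Y) (t k v Y 0) (t k v Y z)).re) (Box γ₀ k)) :
    letI := (theta13LiveOfFamily₂ F N ε₀ ε₂₉ ζ Rz Zt).instVβ₁; letI := (theta13LiveOfFamily₂ F N ε₀ ε₂₉ ζ Rz Zt).instVβ₂
    letI := (theta13LiveOfFamily₂ F N ε₀ ε₂₉ ζ Rz Zt).instιβ
    ∃ γ₁ : ℝ, 0 < γ₁ ∧ γ₁ ≤ (theta13LiveOfFamily₂ F N ε₀ ε₂₉ ζ Rz Zt).γ ∧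
      AtSlopeCont
        (oneLoopSplit_betaOfMerged
          (betaMerged F (mergedTermFamilyMatT F N (TcanOfRecord F N)
            (chiFixed29 F N (theta13LiveOfFamily₂ F N ε₀ ε₂₉ ζ Rz Zt).ν (theta13LiveOfFamily₂ F N ε₀ ε₂₉ ζ Rz Zt).ε₂₉)
            (theta13LiveOfFamily₂ F N ε₀ ε₂₉ ζ Rz Zt).εbg) (theta13LiveOfFamily₂ F N ε₀ ε₂₉ ζ Rz Zt).ρ8
            (theta13LiveOfFamily₂ F N ε₀ ε₂₉ ζ Rz Zt).bV)
          (beta0OfMerged (betaMerged F (mergedTermFamilyMatT F N (TcanOfRecord F N)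
            (chiFixed29 F N (theta13LiveOfFamily₂ F N ε₀ ε₂₉ ζ Rz Zt).ν (theta13LiveOfFamily₂ F N ε₀ ε₂₉ ζ Rz Zt).ε₂₉)
            (theta13LiveOfFamily₂ F N ε₀ ε₂₉ ζ Rz Zt).εbg) (theta13LiveOfFamily₂ F N ε₀ ε₂₉ ζ Rz Zt).ρ8
            (theta13LiveOfFamily₂ F N ε₀ ε₂₉ ζ Rz Zt).bV) (theta13LiveOfFamily₂ F N ε₀ ε₂₉ ζ Rz Zt).v₀)
          (theta13LiveOfFamily₂ F N ε₀ ε₂₉ ζ Rz Zt).γ)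
        γ₁ (B12Normalization.stepBal Nc Lc) :=
  d4AtSlopeOfD1Record13_at_of_family_faithful F N (theta13LiveOfFamily₂ F N ε₀ ε₂₉ ζ Rz Zt) c₀ lamF hγ₀
    (by rw [theta13LiveOfFamily₂_γ]; exact hle) A1 hm hcF hleafF Ps hn hsp h213 hR
    (condsL_faithful_theta13LiveOfFamily₂_of_eps_le F N ε₀ ζ Rz Zt hsmall₁ hA₂) hs Wn instW instWs emb hemb hH D V instV instVs
    Fw hFd r hfac t hconv ha hq hsmall hcont

end AtFamily

/-! ## §3 The same AT NODE 00's ALL-NUMERICS witness family `θ₁₃(n, ε₂₉)` (every numeric letter an argument; K0a FILE 9 §3, the socket def-P11's ∕ K1‴'s numerics instantiate):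
the κ threshold on `n` displayed, N1 discharged modulo it and the displayed `hsmall₁`, `hA₂`; B4 ∕ N26 at the member too -/

section AtNumerics

variable {γ₀ : ℝ} {M : ℕ} [NeZero M] {μ ν : Fin 4} {α₂ : ℝ} {q : Consts190}
variable (n : Stage12Numerics) (ε₂₉ : ℝ) (ζ : ZetaOfRecord F N n.ν n.τ9.M) (Rz : (K : ℕ) → Sect2.Residual (F.P K) (MatA N))
  (Zt : (K : ℕ) → TkResidualW F N (FluctV N) K) (c₀ : B13.Consts)
  (lamF : ResidB13Fam₁₂ F N (theta13LiveOfNumerics F N n ε₂₉ ζ Rz Zt).toStage12Params) (hγ₀ : 0 < γ₀) (hle : γ₀ ≤ n.γ)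
  (hκ : 20 * (64 * Real.log 162 + 1) ≤ n.s2.lf.κ)
  (A1 : (k : ℕ) → (Fin (k + 1) → ℝ) → LDom 4 → Pt 4 → ℝ)
  (hm : letI := (theta13LiveOfNumerics F N n ε₂₉ ζ Rz Zt).instVβ₁; letI := (theta13LiveOfNumerics F N n ε₂₉ ζ Rz Zt).instVβ₂
    letI := (theta13LiveOfNumerics F N n ε₂₉ ζ Rz Zt).instιβ
    ∀ k (v : Fin (k + 1) → ℝ), v ∈ Box γ₀ k →
      betaMerged F (mergedTermFamilyMatT F N (TcanOfRecord F N)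
          (chiFixed29 F N (theta13LiveOfNumerics F N n ε₂₉ ζ Rz Zt).ν (theta13LiveOfNumerics F N n ε₂₉ ζ Rz Zt).ε₂₉)
          (theta13LiveOfNumerics F N n ε₂₉ ζ Rz Zt).εbg) (theta13LiveOfNumerics F N n ε₂₉ ζ Rz Zt).ρ8
          (theta13LiveOfNumerics F N n ε₂₉ ζ Rz Zt).bV k v =
        beta0OfMerged (betaMerged F (mergedTermFamilyMatT F N (TcanOfRecord F N)
            (chiFixed29 F N (theta13LiveOfNumerics F N n ε₂₉ ζ Rz Zt).ν (theta13LiveOfNumerics F N n ε₂₉ ζ Rz Zt).ε₂₉)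
            (theta13LiveOfNumerics F N n ε₂₉ ζ Rz Zt).εbg) (theta13LiveOfNumerics F N n ε₂₉ ζ Rz Zt).ρ8
            (theta13LiveOfNumerics F N n ε₂₉ ζ Rz Zt).bV) (theta13LiveOfNumerics F N n ε₂₉ ζ Rz Zt).v₀ k +
          B12Beta.secondMoment (fun _ _ => limKernel (A1 k v)) μ ν)
  (hcF : ∀ P k v, v ∈ Box γ₀ k →
    (lamF P k v).c = c13OfRecord₁₂ F N (theta13LiveOfNumerics F N n ε₂₉ ζ Rz Zt).toStage12Params { c₀ with ε₁ := ε₂₉ })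
  (hleafF : ∀ P, B13FamLeafOfRecord₁₂ F N (theta13LiveOfNumerics F N n ε₂₉ ζ Rz Zt).toStage12Params { c₀ with ε₁ := ε₂₉ } lamF P)
  (Ps : (k : ℕ) → (Fin (k + 1) → ℝ) → ℕ → B12.RunParams)
  (hn : ∀ k v, v ∈ Box γ₀ k → Tendsto (fun m => (lamF (Ps k v m) k v).n) atTop atTop)
  (hsp : ∀ k v, v ∈ Box γ₀ k → ∀ m, SpLaw (lamF (Ps k v m) k v)) (h213 : ∀ k v, v ∈ Box γ₀ k → ∀ m, Law213 (lamF (Ps k v m) k v))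
  (hR : ∀ k v, v ∈ Box γ₀ k → ∀ m, (lamF (Ps k v m) k v).Restr)
  (hsmall₁ : 2 * ((F.L : ℝ) + 2) ^ 4 * c₀.A₁ * (n.s2.lf.E₀ * c₀.K₀) * ε₂₉ * Real.exp (5 * n.s2.lf.κ + 1) * K₀ 64 8 * 9 * 64 ≤ 1)
  (hA₂ : Real.exp 1 * 9 * 64 * K₀ 64 8 ^ 2 ≤ c₀.A₂)
  (hs : SignsL (c13OfRecord₁₂ F N (theta13LiveOfNumerics F N n ε₂₉ ζ Rz Zt).toStage12Params { c₀ with ε₁ := ε₂₉ }) α₂ q.B₃)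
  (Wn : (k : ℕ) → (Fin (k + 1) → ℝ) → ℕ → Type) (instW : ∀ k v m, NormedAddCommGroup (Wn k v m))
  (instWs : ∀ k v m, NormedSpace ℂ (Wn k v m))
  (emb : (k : ℕ) → (v : Fin (k + 1) → ℝ) → (m : ℕ) → TDom 4 ((lamF (Ps k v m) k v).n + 1) → Wn k v m → (lamF (Ps k v m) k v).Φ)
  (hemb : ∀ k v, v ∈ Box γ₀ k → ∀ m X, ∀ u ∈ ball (0 : Wn k v m) α₂, emb k v m X u ∈ (lamF (Ps k v m) k v).sp2 X)
  (hH : ∀ k v, v ∈ Box γ₀ k → ∀ m (X Z : TDom 4 ((lamF (Ps k v m) k v).n + 1)), Z.1 ⊆ X.1 →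
    DifferentiableOn ℂ (fun u => (lamF (Ps k v m) k v).H Z (emb k v m X u)) (ball 0 α₂))
  (D : (k : ℕ) → (v : Fin (k + 1) → ℝ) → Data190 4 M (NOfLayers fun m => lamF (Ps k v m) k v) (Wn k v) q)
  (V : (k : ℕ) → (Fin (k + 1) → ℝ) → LDom 4 → Type) (instV : ∀ k v Y, NormedAddCommGroup (V k v Y))
  (instVs : ∀ k v Y, NormedSpace ℂ (V k v Y))
  (Fw : (k : ℕ) → (v : Fin (k + 1) → ℝ) → (Y : LDom 4) → V k v Y → ℂ)
  (hFd : ∀ k v, v ∈ Box γ₀ k → ∀ Y, ∃ ρ > 0, DifferentiableOn ℂ (Fw k v Y) (ball 0 ρ))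
  (r : (k : ℕ) → (v : Fin (k + 1) → ℝ) → (m : ℕ) → (Y : LDom 4) → Wn k v m →L[ℂ] V k v Y)
  (hfac : ∀ k v, v ∈ Box γ₀ k → ∀ Y : LDom 4, ∀ᶠ m in atTop, ∀ u ∈ ball (0 : Wn k v m) α₂,
    (lamF (Ps k v m) k v).Ek1 (tproj ((lamF (Ps k v m) k v).n + 1) Y) (emb k v m (tproj ((lamF (Ps k v m) k v).n + 1) Y) u) =
      Fw k v Y (r k v m Y u))
  (t : (k : ℕ) → (v : Fin (k + 1) → ℝ) → (Y : LDom 4) → Pt 4 → V k v Y)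
  (hconv : ∀ k v, v ∈ Box γ₀ k → ∀ (Y : LDom 4) (x : Pt 4),
    Tendsto (fun m => r k v m Y ((D k v).hn m (tproj ((lamF (Ps k v m) k v).n + 1) Y) (proj (((lamF (Ps k v m) k v).n + 1) * M) x)))
      atTop (𝓝 (t k v Y x)))
  (ha : ∀ k v, v ∈ Box γ₀ k → ∀ (Y : LDom 4) (z : Pt 4), A1 k v Y z = (mixedDeriv (Fw k v Y) (t k v Y 0) (t k v Y z)).re)

include hγ₀ hle hκ hm hcF hleafF hn hsp h213 hR hsmall₁ hA₂ hs instW instWs hemb hH hFd hfac hconv ha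

/-- **THE REGISTERED STUB's CONCLUSION AT NODE 00's ALL-NUMERICS WITNESS FAMILY `θ₁₃(n, ε₂₉) = theta13LiveOfNumerics F N n ε₂₉ ζ Rz Zt`** for a (D1) datum's slope `stepBal Nc Lc`:
the κ threshold `hκ : 20·(64·log 162 + 1) ≤ κ(n)` displayed (it pays both κ rows for every block size, p485881), N1 DISCHARGED modulo it and the displayed `hsmall₁` (the open letter
below the threshold in `n`'s letters `E₀(n)`, `κ(n)`) and `hA₂` (`…N26AtRecord13Family.condsL_faithful_theta13LiveOfNumerics_iff_of_kappa_ge`); box `0 < γ₀ ≤ γ(n) = θ₁₃.γ`.  The member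
the K0‴ discharge candidates keyed to print's undetermined constants live at (K0a FILE 9 §3; the two-letter family is the member `n := stage12NumericsOfFamily ε₀`, `rfl`).  A REDUCTION —
instance 0∕1; `stub_d4AtSlopeCont13` NOT proved. [cite: Balaban1988RG2Cluster, Lemma 3 (2.38) p.20 and p.21; Balaban1987RG1, (1.2) p.260, (1.7) p.261, (1.18) p.263, (1.20)-(1.22) p.264, (2.9) p.266 and (5.1) p.292; Balaban1985Variational, (190) p.308] -/
theorem d4AtSlopeOfD1Record13_at_theta13LiveOfNumerics_of_family
    (hq : q.Valid (c13OfRecord₁₂ F N (theta13LiveOfNumerics F N n ε₂₉ ζ Rz Zt).toStage12Params { c₀ with ε₁ := ε₂₉ }).δ₀) {Lc : ℕ} {Nc : ℝ}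
    (hsmall : ε₂₉ * remCoeffL 4 M (c13OfRecord₁₂ F N (theta13LiveOfNumerics F N n ε₂₉ ζ Rz Zt).toStage12Params { c₀ with ε₁ := ε₂₉ }) α₂ q.B₃ ≤
      B12Normalization.stepBal Nc Lc)
    (hcont : ∀ k (Y : LDom 4) (z : Pt 4),
      ContinuousOn (fun v : Fin (k + 1) → ℝ => (mixedDeriv (Fw k v Y) (t k v Y 0) (t k v Y z)).re) (Box γ₀ k)) :
    letI := (theta13LiveOfNumerics F N n ε₂₉ ζ Rz Zt).instVβ₁; letI := (theta13LiveOfNumerics F N n ε₂₉ ζ Rz Zt).instVβ₂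
    letI := (theta13LiveOfNumerics F N n ε₂₉ ζ Rz Zt).instιβ
    ∃ γ₁ : ℝ, 0 < γ₁ ∧ γ₁ ≤ (theta13LiveOfNumerics F N n ε₂₉ ζ Rz Zt).γ ∧
      AtSlopeCont
        (oneLoopSplit_betaOfMerged
          (betaMerged F (mergedTermFamilyMatT F N (TcanOfRecord F N)
            (chiFixed29 F N (theta13LiveOfNumerics F N n ε₂₉ ζ Rz Zt).ν (theta13LiveOfNumerics F N n ε₂₉ ζ Rz Zt).ε₂₉)
            (theta13LiveOfNumerics F N n ε₂₉ ζ Rz Zt).εbg) (theta13LiveOfNumerics F N n ε₂₉ ζ Rz Zt).ρ8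
            (theta13LiveOfNumerics F N n ε₂₉ ζ Rz Zt).bV)
          (beta0OfMerged (betaMerged F (mergedTermFamilyMatT F N (TcanOfRecord F N)
            (chiFixed29 F N (theta13LiveOfNumerics F N n ε₂₉ ζ Rz Zt).ν (theta13LiveOfNumerics F N n ε₂₉ ζ Rz Zt).ε₂₉)
            (theta13LiveOfNumerics F N n ε₂₉ ζ Rz Zt).εbg) (theta13LiveOfNumerics F N n ε₂₉ ζ Rz Zt).ρ8
            (theta13LiveOfNumerics F N n ε₂₉ ζ Rz Zt).bV) (theta13LiveOfNumerics F N n ε₂₉ ζ Rz Zt).v₀)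
          (theta13LiveOfNumerics F N n ε₂₉ ζ Rz Zt).γ)
        γ₁ (B12Normalization.stepBal Nc Lc) :=
  d4AtSlopeOfD1Record13_at_of_family_faithful F N (theta13LiveOfNumerics F N n ε₂₉ ζ Rz Zt) c₀ lamF hγ₀ hle A1 hm hcF hleafF Ps hn hsp h213 hR
    ((condsL_faithful_theta13LiveOfNumerics_iff_of_kappa_ge F N ε₂₉ ζ Rz Zt c₀ hκ).2 ⟨hsmall₁, hA₂⟩) hs Wn instW instWs emb hemb hH D V
    instV instVs Fw hFd r hfac t hconv ha hq hsmall hcont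

omit hγ₀ in
/-- **B4 ON THE BOX AT THE STAGE-13 β OF THE ALL-NUMERICS MEMBER `θ₁₃(n, ε₂₉)` FROM THE FAMILY ROAD + (C-pt)**, the κ threshold on `n` displayed, N1 DISCHARGED modulo it and
`hsmall₁`, `hA₂` (p491248 `betaContH_betaOfRecord₁₃_of_family` at the member's faithful letters).  Instance 0∕1. [cite: Balaban1987RG1, (1.7) p.261, (1.18) p.263, (1.20)-(1.22) p.264, (2.9) p.266 and (5.10) p.293; Balaban1988RG2Cluster, Lemma 3 (2.38) p.20 and p.21; Balaban1985Variational, (190) p.308] -/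
theorem betaContH_betaOfRecord₁₃_theta13LiveOfNumerics_of_family
    (hq : q.Valid (c13OfRecord₁₂ F N (theta13LiveOfNumerics F N n ε₂₉ ζ Rz Zt).toStage12Params { c₀ with ε₁ := ε₂₉ }).δ₀)
    (hcpt : ∀ k (x : Pt 4), ContinuousOn (fun v : Fin (k + 1) → ℝ => limKernel (A1 k v) x) (Box γ₀ k)) :
    BetaContH γ₀ (betaOfRecord₁₃ F N (theta13LiveOfNumerics F N n ε₂₉ ζ Rz Zt)) :=
  betaContH_betaOfRecord₁₃_of_family F N (theta13LiveOfNumerics F N n ε₂₉ ζ Rz Zt) { c₀ with ε₁ := ε₂₉ } lamF hle A1 hm hcF hleafF Ps hn hsp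
    h213 hR ((condsL_faithful_theta13LiveOfNumerics_iff_of_kappa_ge F N ε₂₉ ζ Rz Zt c₀ hκ).2 ⟨hsmall₁, hA₂⟩) hs Wn instW instWs emb hemb hH D V
    instV instVs Fw hFd r hfac t hconv ha hq hcpt

/-- **N26 AT THE DATUM OF RECORD OF THE ALL-NUMERICS MEMBER `θ₁₃(n, ε₂₉)` FROM THE FAMILY ROAD + (C-pt)** on a box `0 < γ₀ ≤ γ(n)` (`βfun_datumOfRecord₁₃`, `rfl`), the κ threshold and the two
residual inequalities displayed; the Stage-13 provisos `hP` at the member displayed (K0a `provisos₁₃_theta13LiveOfNumerics_of_bg`, row P11).  Instance 0∕1; N26 NOT discharged.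
[cite: Balaban1987RG1, (1.7) p.261, (1.18) p.263, (1.20)-(1.22) p.264, (2.9) p.266 and (5.10) p.293; Balaban1988RG2Cluster, p.15, Lemma 3 (2.38) p.20 and p.21; Balaban1985Variational, (190) p.308] -/
theorem n26_datumOfRecord₁₃_theta13LiveOfNumerics_of_family (hP : (theta13LiveOfNumerics F N n ε₂₉ ζ Rz Zt).Provisos₁₃ F N)
    (hq : q.Valid (c13OfRecord₁₂ F N (theta13LiveOfNumerics F N n ε₂₉ ζ Rz Zt).toStage12Params { c₀ with ε₁ := ε₂₉ }).δ₀)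
    (hcpt : ∀ k (x : Pt 4), ContinuousOn (fun v : Fin (k + 1) → ℝ => limKernel (A1 k v) x) (Box γ₀ k)) :
    ∃ γc : ℝ, 0 < γc ∧ BetaContH γc (datumOfRecord₁₃ F N (theta13LiveOfNumerics F N n ε₂₉ ζ Rz Zt) hP).βfun :=
  ⟨γ₀, hγ₀, betaContH_betaOfRecord₁₃_theta13LiveOfNumerics_of_family F N n ε₂₉ ζ Rz Zt c₀ lamF hle hκ A1 hm hcF hleafF Ps hn hsp h213 hR
    hsmall₁ hA₂ hs Wn instW instWs emb hemb hH D V instV instVs Fw hFd r hfac t hconv ha hq hcpt⟩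

end AtNumerics

end Summit.QuantumFields.YangMills.Theorems.BalabanUVNodesN26AtRecord13K2Stub

end
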